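import Literature.Geometry.Lorentzian.KerrRedShiftTimelike
import HarnessLib

/-!
# The red-shift multiplier is timelike and transversal to the admissible leaves on an EXPLICIT
# collar of the horizon, uniformly up to extremality
(namespace `Literature.Geometry.Lorentzian.Kerr`.)

`KerrRedShiftTimelike.lean` proves that `N = (1 + h₁(r − r₊))K + (1 + f₁(r − r₊))k` is timelike,
future directed and uniformly transversal to the admissible leaves on SOME collar `|r − r₊| ≤ η`, by
the compactness "collar principle" (`Kerr.exists_collar_of_pos_on_horizon`), so that `η = η(M, a, h₁, f₁)`
is opaque. For the `κ`-explicit red-shift estimate (crux `KappaExplicitWaveDecay`) the collar must be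
explicit and uniform in `a`. Here, for equal parameters `h₁ = f₁ = h ≥ 0` (the choice of
`KerrRedShiftCoercivityPoly.lean`) and the exterior collar `r₊ ≤ r ≤ r₊ + M/16384` with `h(r − r₊) ≤ 1`:

* `Kerr.abs_hawkingG_le` — the cubic `G` of `Kerr.hawking_F_factor` is bounded by `30M` on `[r₊, 3M]`;
* `Kerr.bilin_hawkingVector_le` — `g(K, K) ≤ 30(r − r₊)/M` on `r₊ ≤ r ≤ r₊ + M` (from
  `ρ²g(K, K) = −(1 − σ)Δ + σ(r − r₊)G − σ²a⁴Δ/(4M²r₊²) ≤ (r − r₊)|G|`, DRSR Lemma 4.7.2's computation);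
* `Kerr.nullCovector_hawkingVector_mem_Icc` — `½ ≤ ℓ(K) ≤ 1` (`ℓ(K) = 1 − ω₊a(x₁² + x₂²)/(r² + a²)`,
  `ω₊a = a²/(2Mr₊) ≤ ½`): the transversality of the frame `{K, k}` does not degenerate at extremality;
* `Kerr.spatialNorm_redShiftVec_le` — `‖N⃗‖ ≤ (1 + h(r − r₊))(|ω₊|‖Φ⃗‖ + 1)`;
* `Kerr.redShift_timelike_collar_poly` — **on the collar: `g(N, N) ≤ −½`, `1 ≤ N⁰`, and
  `¼ ≤ ∑_μ n_μN^μ` for every admissible conormal `n`.**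

## References
* M. Dafermos, I. Rodnianski, Y. Shlapentokh-Rothman, arXiv:1402.7034, §2.2.2, Lemma 4.7.2, Prop. 4.5.1
  (key `DafermosRodnianskiShlapentokhrothman2014`).
* M. Dafermos, I. Rodnianski, arXiv:0811.0354, §3.3.2, Thm. 7.1 (key `DafermosRodnianski2008`).
-/

noncomputable section

open Set Filter
open scoped Topology

namespace Literature.Geometry.Lorentzian.Kerr

variable {M a : ℝ} {x : E4}

/-- **The cubic `G` of `hawking_F_factor` is bounded**: for `0 < M`, `a² ≤ M²`, `M ≤ r₊' ≤ 2M` and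
`r₊' ≤ r ≤ 3M`, `|G(r)| ≤ 30M`, `G(r) = −(r + r₊') + 2M − 2a²/r₊' + a²(r + r₊')(r² + r₊'² + 2a²)/(4M²r₊'²)`.
[folklore] -/
theorem abs_hawkingG_le {M a rp r : ℝ} (hM : 0 < M) (ha : a ^ 2 ≤ M ^ 2) (hrp1 : M ≤ rp)
    (hrp2 : rp ≤ 2 * M) (hr1 : rp ≤ r) (hr2 : r ≤ 3 * M) :
    |-(r + rp) + 2 * M - 2 * a ^ 2 / rp + a ^ 2 * (r + rp) * (r ^ 2 + rp ^ 2 + 2 * a ^ 2) /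
      (4 * M ^ 2 * rp ^ 2)| ≤ 30 * M := by
  have hrp : 0 < rp := hM.trans_le hrp1
  have hr0 : 0 < r := hrp.trans_le hr1
  have h1 : |-(r + rp) + 2 * M| ≤ 7 * M := by
    rw [abs_le]; constructor <;> linarith
  have h2 : |2 * a ^ 2 / rp| ≤ 2 * M := by
    rw [abs_of_nonneg (by positivity), div_le_iff₀ hrp]
    nlinarith
  have h3 : |a ^ 2 * (r + rp) * (r ^ 2 + rp ^ 2 + 2 * a ^ 2) / (4 * M ^ 2 * rp ^ 2)| ≤ 19 * M := by
    rw [abs_of_nonneg (by positivity), div_le_iff₀ (by positivity)]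
    have h4 : a ^ 2 * (r + rp) * (r ^ 2 + rp ^ 2 + 2 * a ^ 2) ≤ M ^ 2 * (5 * M) * (15 * M ^ 2) := by
      refine mul_le_mul (mul_le_mul ha (by linarith) (by positivity) (by positivity)) ?_
        (by positivity) (by positivity)
      nlinarith
    have h5 : M ^ 2 * M ^ 2 ≤ M ^ 2 * rp ^ 2 := by
      refine mul_le_mul_of_nonneg_left ?_ (by positivity)
      exact pow_le_pow_left₀ hM.le hrp1 2
    nlinarith
  calc _ ≤ |-(r + rp) + 2 * M - 2 * a ^ 2 / rp| +
        |a ^ 2 * (r + rp) * (r ^ 2 + rp ^ 2 + 2 * a ^ 2) / (4 * M ^ 2 * rp ^ 2)| := abs_add_le _ _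
    _ ≤ (|-(r + rp) + 2 * M| + |2 * a ^ 2 / rp|) +
        |a ^ 2 * (r + rp) * (r ^ 2 + rp ^ 2 + 2 * a ^ 2) / (4 * M ^ 2 * rp ^ 2)| :=
        add_le_add (abs_sub _ _) le_rfl
    _ ≤ 7 * M + 2 * M + 19 * M := add_le_add (add_le_add h1 h2) h3
    _ ≤ 30 * M := by linarith

/-- **`g(K, K) ≤ 30(r − r₊)/M` on `r₊ ≤ r ≤ r₊ + M`** (`|a| ≤ M`, `0 < M`): by DRSR's computation
(`Kerr.hawking_rho_sq_mul_eq`, `Kerr.hawking_F_factor`)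
`ρ²g(K, K) = −(1 − σ)Δ + σ(r − r₊)G(r) − σ²a⁴Δ/(4M²r₊²) ≤ (r − r₊)|G(r)| ≤ 30M(r − r₊)`
with `σ = (r² − x₃²)/r² ∈ [0, 1]`, `Δ = (r − r₊)(r − r₊ + 2(r₊ − M)) ≥ 0`, `ρ² = r² + a²(1 − σ) ≥ r² ≥ M²`.
(`K` is null on `𝓗⁺`; off it `g(K, K)` is small, which is all the red-shift multiplier needs.)
[cite: DafermosRodnianskiShlapentokhrothman2014, Lemma 4.7.2 (proof)] -/
theorem bilin_hawkingVector_le (hMa : |a| ≤ M) (hM : 0 < M) (hr₁ : rPlus M a ≤ radius a x)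
    (hr₂ : radius a x ≤ rPlus M a + M) :
    bilin M a x (hawkingVector M a x) (hawkingVector M a x) ≤ 30 * (radius a x - rPlus M a) / M := by
  have hrp0 : 0 < rPlus M a := rPlus_pos hM a
  have hrpM : M ≤ rPlus M a := by
    linarith [rPlus_sub_self M a, Real.sqrt_nonneg (M ^ 2 - a ^ 2)]
  have hrp2 : rPlus M a ≤ 2 * M := rPlus_le_two_mul_self hM.le a
  have hx : 0 < radius a x := hrp0.trans_le hr₁
  have ha2 : a ^ 2 ≤ M ^ 2 := by nlinarith [sq_abs a, abs_nonneg a]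
  have hra := rPlus_sq_add_sq hMa
  set r := radius a x with hr_def
  set s := r - rPlus M a with hs_def
  have hs0 : 0 ≤ s := by rw [hs_def]; linarith
  -- `σ ∈ [0, 1]`, `ρ² ≥ r²`
  set σ : ℝ := (r ^ 2 - x 3 ^ 2) / r ^ 2 with hσ_def
  have hz := sq_apply_three_le_radius_sq a hx
  have hσ0 : 0 ≤ σ := div_nonneg (by rw [hr_def]; linarith) (sq_nonneg r)
  have hσ1 : σ ≤ 1 := by
    rw [hσ_def, div_le_one (by positivity)]; linarith [sq_nonneg (x 3)]
  set ρ2 : ℝ := r ^ 2 + a ^ 2 * (1 - σ) with hρ2_def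
  have hρ2r : r ^ 2 ≤ ρ2 := by
    have : 0 ≤ a ^ 2 * (1 - σ) := mul_nonneg (sq_nonneg a) (by linarith)
    linarith
  have hρ2 : 0 < ρ2 := lt_of_lt_of_le (by positivity) hρ2r
  -- the formula for `g(K, K)` and DRSR's identity
  have hK : hawkingVector M a x = E4.basisVector 0 + horizonAngularVelocity M a • axialVector x := rfl
  have hbil := bilin_basisVector_add_smul_axialVector M a (horizonAngularVelocity M a) hx
  rw [← hK, ← hr_def] at hbil
  have key := hawking_rho_sq_mul_eq (M := M) (a := a) (r := r) (σ := σ)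
    (by positivity : 2 * M * rPlus M a ≠ 0) hρ2.ne'
  have hF := hawking_F_factor hMa hM r
  -- `Δ = s(s + 2(r₊ − M)) ≥ 0`
  have hΔeq : r ^ 2 - 2 * M * r + a ^ 2 = s * (s + 2 * (rPlus M a - M)) := by
    rw [hs_def]; linear_combination hra
  have hΔ0 : 0 ≤ r ^ 2 - 2 * M * r + a ^ 2 := by
    rw [hΔeq]; exact mul_nonneg hs0 (by linarith)
  -- `ρ² g(K,K) = −(1 − σ)Δ + σ s G − σ² a⁴Δ/(4M²r₊²)`
  set G : ℝ := -(r + rPlus M a) + 2 * M - 2 * a ^ 2 / rPlus M a +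
    a ^ 2 * (r + rPlus M a) * (r ^ 2 + rPlus M a ^ 2 + 2 * a ^ 2) / (4 * M ^ 2 * rPlus M a ^ 2)
    with hG_def
  have hG : |G| ≤ 30 * M := abs_hawkingG_le hM ha2 hrpM hrp2 hr₁ (by linarith)
  have hE : ρ2 * bilin M a x (hawkingVector M a x) (hawkingVector M a x) =
      -((1 - σ) * (r ^ 2 - 2 * M * r + a ^ 2)) + σ * ((r - rPlus M a) * G) -
        σ ^ 2 * (a ^ 4 * (r ^ 2 - 2 * M * r + a ^ 2) / (4 * M ^ 2 * rPlus M a ^ 2)) := by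
    rw [hbil, key]
    have e : a ^ 2 - 2 * a ^ 2 * r / rPlus M a + a ^ 2 * (r ^ 2 + a ^ 2) ^ 2 / (4 * M ^ 2 * rPlus M a ^ 2)
        = (r - rPlus M a) * G + (r ^ 2 - 2 * M * r + a ^ 2) := by
      rw [hG_def]; linarith [hF]
    rw [e]
    ring
  have hbound : ρ2 * bilin M a x (hawkingVector M a x) (hawkingVector M a x) ≤ 30 * M * s := by
    rw [hE, ← hs_def]
    have h1 : 0 ≤ (1 - σ) * (r ^ 2 - 2 * M * r + a ^ 2) := mul_nonneg (by linarith) hΔ0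
    have h2 : 0 ≤ σ ^ 2 * (a ^ 4 * (r ^ 2 - 2 * M * r + a ^ 2) / (4 * M ^ 2 * rPlus M a ^ 2)) := by
      have : 0 ≤ a ^ 4 := by positivity
      positivity
    have h3 : σ * (s * G) ≤ 30 * M * s := by
      calc σ * (s * G) ≤ |σ * (s * G)| := le_abs_self _
        _ = σ * (s * |G|) := by rw [abs_mul, abs_mul, abs_of_nonneg hσ0, abs_of_nonneg hs0]
        _ ≤ 1 * (s * (30 * M)) :=
            mul_le_mul hσ1 (mul_le_mul_of_nonneg_left hG hs0) (by positivity) zero_le_one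
        _ = 30 * M * s := by ring
    linarith
  -- divide by `ρ² ≥ M²`
  have hρ2M : M ^ 2 ≤ ρ2 := le_trans (pow_le_pow_left₀ hM.le (hrpM.trans hr₁) 2) hρ2r
  by_cases hb : bilin M a x (hawkingVector M a x) (hawkingVector M a x) ≤ 0
  · exact hb.trans (by positivity)
  · push Not at hb
    rw [le_div_iff₀ hM]
    have h1 : M ^ 2 * bilin M a x (hawkingVector M a x) (hawkingVector M a x) ≤ 30 * M * s :=
      (mul_le_mul_of_nonneg_right hρ2M hb.le).trans hbound
    have h2 : M * (M * bilin M a x (hawkingVector M a x) (hawkingVector M a x)) ≤ M * (30 * s) := by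
      calc M * (M * bilin M a x (hawkingVector M a x) (hawkingVector M a x))
          = M ^ 2 * bilin M a x (hawkingVector M a x) (hawkingVector M a x) := by ring
        _ ≤ 30 * M * s := h1
        _ = M * (30 * s) := by ring
    have h3 := le_of_mul_le_mul_left h2 hM
    linarith only [h3]

/-- **`½ ≤ ℓ(K) ≤ 1`** wherever `r > 0` (`|a| ≤ M`, `0 < M`): `ℓ(K) = 1 − ω₊a(x₁² + x₂²)/(r² + a²)`
with `0 ≤ ω₊a = a²/(2Mr₊) ≤ ½` (`a² ≤ M² ≤ Mr₊`) and `x₁² + x₂² ≤ r² + a²`. This is the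
non-degeneracy `−g(K, k) = ℓ(K) ≥ ½` of the horizon frame `{K, k}` up to extremality.
[cite: DafermosRodnianskiShlapentokhrothman2014, §2.2.2] -/
theorem nullCovector_hawkingVector_mem_Icc (hMa : |a| ≤ M) (hM : 0 < M) (hx : 0 < radius a x) :
    2⁻¹ ≤ nullCovector a x (hawkingVector M a x) ∧ nullCovector a x (hawkingVector M a x) ≤ 1 := by
  have hrp0 : 0 < rPlus M a := rPlus_pos hM a
  have hrpM : M ≤ rPlus M a := by
    linarith [rPlus_sub_self M a, Real.sqrt_nonneg (M ^ 2 - a ^ 2)]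
  have ha2 : a ^ 2 ≤ M ^ 2 := by nlinarith [sq_abs a, abs_nonneg a]
  have hK : hawkingVector M a x = E4.basisVector 0 + horizonAngularVelocity M a • axialVector x := rfl
  have hℓ : nullCovector a x (hawkingVector M a x) =
      1 - horizonAngularVelocity M a * a * ((x 1 ^ 2 + x 2 ^ 2) / (radius a x ^ 2 + a ^ 2)) := by
    rw [hK, map_add, map_smul, nullCovector_basisVector_zero, nullCovector_axialVector, smul_eq_mul]
    ring
  have hω : horizonAngularVelocity M a * a = a ^ 2 / (2 * M * rPlus M a) := by
    rw [horizonAngularVelocity]; ring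
  have hω0 : 0 ≤ horizonAngularVelocity M a * a := by rw [hω]; positivity
  have hω1 : horizonAngularVelocity M a * a ≤ 2⁻¹ := by
    rw [hω, div_le_iff₀ (by positivity)]
    nlinarith [mul_le_mul_of_nonneg_left hrpM hM.le]
  have hq0 : 0 ≤ (x 1 ^ 2 + x 2 ^ 2) / (radius a x ^ 2 + a ^ 2) := by positivity
  have hq1 : (x 1 ^ 2 + x 2 ^ 2) / (radius a x ^ 2 + a ^ 2) ≤ 1 := by
    rw [div_le_one (by positivity)]; exact sq_add_sq_le_radius_sq_add hx
  rw [hℓ]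
  constructor
  · nlinarith [mul_le_mul hω1 hq1 hq0 (by norm_num)]
  · nlinarith [mul_nonneg hω0 hq0]

/-- **`‖N⃗‖ ≤ (1 + h(r − r₊))(|ω₊|‖Φ⃗‖ + 1)`** for equal parameters `h₁ = f₁ = h` with
`0 ≤ 1 + h(r − r₊)` (`N⃗ = (1 + hs)(ω₊Φ⃗ − ℓ⃗)`, `‖ℓ⃗‖ = 1`). [folklore] -/
theorem spatialNorm_redShiftVec_le (h : ℝ) (hx : 0 < radius a x) (hc : 0 ≤ 1 + h * (radius a x - rPlus M a)) :
    E4.spatialNorm (redShiftVec M a h h x) ≤ (1 + h * (radius a x - rPlus M a)) *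
      (|horizonAngularVelocity M a| * E4.spatialNorm (axialVector x) + 1) := by
  set c : ℝ := 1 + h * (radius a x - rPlus M a) with hc_def
  have hK : hawkingVector M a x = E4.basisVector 0 + horizonAngularVelocity M a • axialVector x := rfl
  have h0 : E4.spatial (E4.basisVector 0) = 0 := by
    ext i
    rw [E4.spatial_apply]
    fin_cases i <;> simp [E4.basisVector]
  have hN : redShiftVec M a h h x = c • hawkingVector M a x + (-c) • nullVector a x := rfl
  have hsK : E4.spatialNorm (hawkingVector M a x) =
      |horizonAngularVelocity M a| * E4.spatialNorm (axialVector x) := by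
    rw [E4.spatialNorm, hK, map_add, map_smul, h0, zero_add, norm_smul, Real.norm_eq_abs, E4.spatialNorm]
  rw [E4.spatialNorm, hN, map_add, map_smul, map_smul]
  calc ‖c • E4.spatial (hawkingVector M a x) + (-c) • E4.spatial (nullVector a x)‖
      ≤ ‖c • E4.spatial (hawkingVector M a x)‖ + ‖(-c) • E4.spatial (nullVector a x)‖ := norm_add_le _ _
    _ = c * E4.spatialNorm (hawkingVector M a x) + c * E4.spatialNorm (nullVector a x) := by
        rw [norm_smul, norm_smul, norm_neg, Real.norm_eq_abs, abs_of_nonneg hc, E4.spatialNorm,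
          E4.spatialNorm]
    _ = c * (|horizonAngularVelocity M a| * E4.spatialNorm (axialVector x) + 1) := by
        rw [hsK, spatialNorm_nullVector hx]; ring

/-- **`|ω₊|‖Φ⃗‖ ≤ ¾` on `r₊ ≤ r ≤ r₊ + M/16384`** (`|a| ≤ M`, `0 < M`):
`ω₊²‖Φ⃗‖² ≤ a²(r² + a²)/(4M²r₊²) ≤ 9/16` (`a² ≤ M² ≤ Mr₊`, `r² + a² ≤ 2Mr₊ + 2r₊s + s²`). [folklore] -/
theorem abs_horizonAngularVelocity_mul_spatialNorm_le (hMa : |a| ≤ M) (hM : 0 < M)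
    (hr₁ : rPlus M a ≤ radius a x) (hr₂ : radius a x ≤ rPlus M a + M / 16384) :
    |horizonAngularVelocity M a| * E4.spatialNorm (axialVector x) ≤ 3 / 4 := by
  have hrp0 : 0 < rPlus M a := rPlus_pos hM a
  have hrpM : M ≤ rPlus M a := by
    linarith [rPlus_sub_self M a, Real.sqrt_nonneg (M ^ 2 - a ^ 2)]
  have hx : 0 < radius a x := hrp0.trans_le hr₁
  have ha2 : a ^ 2 ≤ M ^ 2 := by nlinarith [sq_abs a, abs_nonneg a]
  have hra := rPlus_sq_add_sq hMa
  have h0 : 0 ≤ |horizonAngularVelocity M a| * E4.spatialNorm (axialVector x) :=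
    mul_nonneg (abs_nonneg _) (E4.spatialNorm_nonneg _)
  have hsq : (|horizonAngularVelocity M a| * E4.spatialNorm (axialVector x)) ^ 2 ≤ (3 / 4) ^ 2 := by
    rw [mul_pow, sq_abs, spatialNorm_axialVector_sq, horizonAngularVelocity, div_pow]
    have h1 := sq_add_sq_le_radius_sq_add (a := a) hx
    have h2 : radius a x ^ 2 + a ^ 2 ≤ 2 * M * rPlus M a + 2 * rPlus M a * (M / 16384) + (M / 16384) ^ 2 := by
      nlinarith [hr₁, hr₂, hrp0, hra]
    rw [div_mul_eq_mul_div, div_le_iff₀ (by positivity)]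
    have h3 : a ^ 2 * (x 1 ^ 2 + x 2 ^ 2) ≤ M ^ 2 * (2 * M * rPlus M a + 2 * rPlus M a * (M / 16384) +
        (M / 16384) ^ 2) := mul_le_mul ha2 (h1.trans h2) (by positivity) (by positivity)
    nlinarith [h3, mul_le_mul_of_nonneg_left hrpM (by positivity : (0 : ℝ) ≤ M ^ 3)]
  exact (pow_le_pow_iff_left₀ h0 (by norm_num) two_ne_zero).1 hsq

/-- **The red-shift multiplier is timelike, future directed and uniformly transversal to the admissible
leaves on the explicit collar** `r₊ ≤ r ≤ r₊ + M/16384`, for equal parameters `h₁ = f₁ = h ≥ 0` with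
`h(r − r₊) ≤ 1` (`|a| < M`): `g(N, N) ≤ −½`, `1 ≤ N⁰`, and `¼ ≤ ∑_μ n_μ N^μ` for every admissible
conormal `n = (1, −q)`, `|q| ≤ 1`. Proof: `g(N, N) = (1 + hs)²(g(K, K) − 2ℓ(K))` with
`g(K, K) ≤ 30s/M ≤ 1/500`, `ℓ(K) ≥ ½`; `N⁰ = 2 + 2hs`; `∑ n_μN^μ ≥ N⁰ − ‖N⃗‖ ≥ (1 + hs)(1 − |ω₊|‖Φ⃗‖)`
with `|ω₊|‖Φ⃗‖ ≤ ¾`. This is the `κ`-uniform replacement of `Kerr.exists_redShift_timelike_collar`.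
[cite: DafermosRodnianskiShlapentokhrothman2014, Prop. 4.5.1] -/
theorem redShift_timelike_collar_poly (hMa : IsSubextremal M a) {h : ℝ} (hh : 0 ≤ h)
    (hr₁ : rPlus M a ≤ radius a x) (hr₂ : radius a x ≤ rPlus M a + M / 16384)
    (hhs : h * (radius a x - rPlus M a) ≤ 1) :
    bilin M a x (redShiftVec M a h h x) (redShiftVec M a h h x) ≤ -2⁻¹ ∧
      1 ≤ redShiftVec M a h h x 0 ∧
      ∀ n ∈ admissibleConormals, 4⁻¹ ≤ ∑ μ, n μ * redShiftVec M a h h x μ := by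
  have hM : 0 < M := hMa.pos
  have hMa' : |a| ≤ M := le_of_lt hMa
  have hrp0 : 0 < rPlus M a := rPlus_pos hM a
  have hx : 0 < radius a x := hrp0.trans_le hr₁
  set s := radius a x - rPlus M a with hs_def
  have hs0 : 0 ≤ s := by rw [hs_def]; linarith
  have hsM : s ≤ M / 16384 := by rw [hs_def]; linarith
  have hc0 : 1 ≤ 1 + h * s := by nlinarith
  have hc1 : 1 + h * s ≤ 2 := by linarith
  refine ⟨?_, ?_, fun n hn ↦ ?_⟩
  · -- timelike
    have hKK := bilin_hawkingVector_le hMa' hM hr₁ (by linarith)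
    obtain ⟨hℓ, -⟩ := nullCovector_hawkingVector_mem_Icc hMa' hM hx
    rw [bilin_redShiftVec M a h h hx, ← hs_def]
    rw [← hs_def] at hKK
    have h1 : bilin M a x (hawkingVector M a x) (hawkingVector M a x) ≤ 1 / 500 := by
      refine hKK.trans ?_
      rw [div_le_div_iff₀ hM (by norm_num)]; linarith
    have h2 : bilin M a x (hawkingVector M a x) (hawkingVector M a x) -
        2 * nullCovector a x (hawkingVector M a x) ≤ -2⁻¹ := by linarith
    have h3 : (1 + h * s) ^ 2 * (bilin M a x (hawkingVector M a x) (hawkingVector M a x) -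
        2 * nullCovector a x (hawkingVector M a x)) ≤ 1 * -2⁻¹ := by
      have h4 : 1 ≤ (1 + h * s) ^ 2 := by nlinarith
      nlinarith
    linarith [h3]
  · -- future directed
    rw [redShiftVec_apply_zero, ← hs_def]; nlinarith
  · -- transversal
    have h1 := apply_zero_sub_spatialNorm_le hn (redShiftVec M a h h x)
    have h2 := spatialNorm_redShiftVec_le (M := M) h hx (by rw [← hs_def]; linarith)
    have h3 := abs_horizonAngularVelocity_mul_spatialNorm_le hMa' hM hr₁ hr₂
    rw [redShiftVec_apply_zero, ← hs_def] at h1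
    rw [← hs_def] at h2
    have h4 : (1 + h * s) * (|horizonAngularVelocity M a| * E4.spatialNorm (axialVector x) + 1) ≤
        (1 + h * s) * (3 / 4 + 1) := mul_le_mul_of_nonneg_left (by linarith) (by linarith)
    nlinarith [h1, h2, h4, hc0, hc1]

end Literature.Geometry.Lorentzian.Kerr

end
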